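import Summits.BirchSwinnertonDyer.BirchSwinnertonDyer.Theorems.SignedLowerHalvesSmallImageLowerHalfBothSignsRttD2J1CyclotomicCarrier
import Literature.NumberTheory.ComplexMultiplication.EllipticUnits.ImaginaryQuadraticMainConjectureCarriersOCores
import HarnessLib

/-!
# Route `SignedLowerHalves`, crux L `SmallImageLowerHalfBothSigns` (stmt-BirchSwinnertonDyer-23599), line `rtt_w3` v14 — E2, junction row (J2), MAP half (untwisted):
# THE CORESTRICTION `res : 𝐇¹(𝒪_K[1/p𝔣], Λ_{𝒪,2}(θ)(1)) → 𝐇¹_{supp(p𝔣)}(K^{(1)}_∞/K, 𝒪(θ)(1)) = B` from the `ℤ_p²`-tower to the `κ₁`-line, on honda's pinned carriers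

INPUTS hand `bsd-inputs-honda-p1` g23 under LEAD `cruxlead-stmt-BirchSwinnertonDyer-23599` g11 (BRIEF-E2 rev 4 §3 row J2 «`s : Hsp →ₗ[Λ_𝒪] B` (sp¹)»; sequel of
`…RttD2J1CyclotomicCarrier` (p782087, the carrier `B`)). The specialisation `sp¹` of the junction is `cor ∘ tw` (bus 2026-08-30T18:1xZ): `tw` the twist by the
character `ψ_u` of the frame (J2-a, awaiting the LEAD's convention), `cor` the UNTWISTED, convention-free corestriction from the `ℤ_p²`-tower
`K̃_n = K̄^{pairLayerSubgroup κ₁ κ₂ n}` to the `κ₁`-tower `K^{(1)}_n = K̄^{κ₁.layerSubgroup n}` (`pairLayerSubgroup κ₁ κ₂ n ≤ κ₁.layerSubgroup n` is `inf_le_left`)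
— THIS FILE, for the degree `i = 1` of the junction:
* §1 `spLevel n k i` — levelwise `cor_{K̃_n/K^{(1)}_n} = relCoresO` (honda g22), and its compatibility with the corestrictions in `n` (degree `1`: transitivity
  `relCoresO_relCoresO_one`), the reductions in `k` (`relCoresO_levelRedO`), the conjugations (`relCoresO_levelConjO`) and the constants (`relCoresO_levelScalarO`);
* §2 for pinned data `D₂ : IwasawaCohomologyDataO S κ₁ κ₂ γ₁ γ₂ θ 𝔣 1` (two variables) and `D₁ : CycIwasawaCohomologyDataO S κ₁ γ₁ θ (suppPF p 𝔣) 1` (the `κ₁`-line):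
  ★★ `exists_coresHom` — an additive `res : D₂.H →+ D₁.H` PINNED by `D₁.proj n k (res x) = spLevel n k 1 (D₂.proj n k x)` (via (P4)/(P3) of `D₁`), UNIQUE
  (`coresHom_unique`), with ★ `res (T₁ • x) = T • res x`, ★ `res (C (C c) • x) = C c • res x` (so `res` is `𝒪⟦T₁⟧`-linear for `T₁ ↦ T`) and ★ the `T₂`-clause
  `D₁.proj n k (res (C X • x)) = conj_{γ₂} (D₁.proj n k (res x)) − D₁.proj n k (res x)`; ★ if `γ₂ ∈ κ₁.kerSubgroup` (dual basis) then `res (C X • x) = 0`, i.e. `res`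
  kills `T₂ • D₂.H` and factors through the UNTWISTED specialisation `D₂.H / T₂`.
THEOREMS + one transparent `def` (`spLevel`, an abbreviation of `relCoresO`); no named fact, no `sorry`; crux L, crux M, E2 and BSD remain OPEN and are proved
for NO curve by any of this. References: [NeukirchSchmidtWingberg2008] I §5 Prop. 1.5.2–1.5.4 (cor: natural, transitive, equivariant); [JohnsonLeungKings2011] §4.2
Def. 4.2 (94) (arXiv 0804.2828 p0012:L80–112); [Kato2004Asterisque] §8.2 (p. 180), §12.2 (12.2.1) (p. 220).
-/

set_option autoImplicit false
-- the Theorems namespace of this sub repeats the summit name by design (D-0017 nested layout)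
set_option linter.dupNamespace false

noncomputable section

open scoped NumberField PowerSeries
open CategoryTheory Field IsDedekindDomain
open Literature.NumberTheory.GaloisRepresentations
open Literature.NumberTheory.EllipticCurves
open Literature.NumberTheory.ComplexMultiplication.EllipticUnits
open Literature.NumberTheory.ComplexMultiplication.EllipticUnits.JohnsonLeungKings2011
open Summit.BirchSwinnertonDyer.BirchSwinnertonDyer.Theorems.SmallImageRttD2J1

namespace Summit.BirchSwinnertonDyer.BirchSwinnertonDyer.Theorems.SmallImageRttD2J2

/-! ## §1 The levelwise corestriction `cor_{K̃_n / K^{(1)}_n}` and its compatibilities -/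

section Level

variable {K : Type} [Field K] [NumberField K] {p : ℕ} [Fact p.Prime] (S : Set (PadicAlgCl p))
  (κ₁ κ₂ : ZpExtension K p) (θ : absoluteGaloisGroup K →ₜ* (padicCoeffIntegers S)ˣ) (𝔣 : Ideal (𝓞 K))

/-- **`cor_{K̃_n/K^{(1)}_n} : H^i(G_S(K̃_n), 𝒪 ⊗ μ_{p^k} ⊗ θ) → H^i(G_S(K^{(1)}_n), 𝒪 ⊗ μ_{p^k} ⊗ θ)`** (`S = supp(p𝔣)`): honda g22's `relCoresO` along
`pairLayerSubgroup κ₁ κ₂ n ≤ κ₁.layerSubgroup n`. [cite: NeukirchSchmidtWingberg2008, I §5 Prop. 1.5.3] [cite: JohnsonLeungKings2011, Def. 4.2 (94) (arXiv p0012:L94)] -/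
def spLevel (n k i : ℕ) : layerCohO S κ₁ κ₂ θ 𝔣 n k i →+ cycLayerCohO S κ₁ θ (suppPF p 𝔣) n k i :=
  relCoresO S (suppPF p 𝔣) θ (inf_le_left : JohnsonLeungKings2011.pairLayerSubgroup κ₁ κ₂ n ≤ κ₁.layerSubgroup n) (κ₁.isOpen_layerSubgroup n)
    (JohnsonLeungKings2011.isOpen_pairLayerSubgroup κ₁ κ₂ n) k i

/-- **Compatibility with the corestrictions in `n`** (degree `1`): `cor_{K̃_n/K^{(1)}_n} ∘ cor_{K̃_{n+1}/K̃_n} = cor_{K^{(1)}_{n+1}/K^{(1)}_n} ∘ cor_{K̃_{n+1}/K^{(1)}_{n+1}}`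
(both are `cor_{K̃_{n+1}/K^{(1)}_n}`, transitivity `relCoresO_relCoresO_one`). [cite: NeukirchSchmidtWingberg2008, I §5 Prop. 1.5.3 (iii)] -/
theorem spLevel_layerCoresO_one (n k : ℕ) (y : layerCohO S κ₁ κ₂ θ 𝔣 (n + 1) k 1) :
    spLevel S κ₁ κ₂ θ 𝔣 n k 1 (layerCoresO S κ₁ κ₂ θ 𝔣 n k 1 y) =
      cycLayerCoresO S κ₁ θ (suppPF p 𝔣) n k 1 (spLevel S κ₁ κ₂ θ 𝔣 (n + 1) k 1 y) := by
  rw [spLevel, layerCoresO, relCoresO_relCoresO_one, spLevel, cycLayerCoresO, relCoresO_relCoresO_one]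

/-- **Compatibility with the reductions in `k`** (all degrees; `relCoresO_levelRedO`). [cite: NeukirchSchmidtWingberg2008, I §5 Prop. 1.5.2] -/
theorem spLevel_layerRedO (n k i : ℕ) (y : layerCohO S κ₁ κ₂ θ 𝔣 n (k + 1) i) :
    spLevel S κ₁ κ₂ θ 𝔣 n k i (layerRedO S κ₁ κ₂ θ 𝔣 n k i y) = cycLayerRedO S κ₁ θ (suppPF p 𝔣) n k i (spLevel S κ₁ κ₂ θ 𝔣 n (k + 1) i y) :=
  relCoresO_levelRedO S (suppPF p 𝔣) θ (inf_le_left : JohnsonLeungKings2011.pairLayerSubgroup κ₁ κ₂ n ≤ κ₁.layerSubgroup n)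
    (κ₁.isOpen_layerSubgroup n) (JohnsonLeungKings2011.isOpen_pairLayerSubgroup κ₁ κ₂ n) k i y

/-- **Compatibility with the conjugations** (all degrees; `relCoresO_levelConjO`). [cite: NeukirchSchmidtWingberg2008, I §5 Prop. 1.5.4] -/
theorem spLevel_layerConjO (n k i : ℕ) (γ : absoluteGaloisGroup K) (y : layerCohO S κ₁ κ₂ θ 𝔣 n k i) :
    spLevel S κ₁ κ₂ θ 𝔣 n k i (layerConjO S κ₁ κ₂ θ 𝔣 n k i γ y) = cycLayerConjO S κ₁ θ (suppPF p 𝔣) n k i γ (spLevel S κ₁ κ₂ θ 𝔣 n k i y) :=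
  relCoresO_levelConjO S (suppPF p 𝔣) θ (inf_le_left : JohnsonLeungKings2011.pairLayerSubgroup κ₁ κ₂ n ≤ κ₁.layerSubgroup n)
    (κ₁.isOpen_layerSubgroup n) (JohnsonLeungKings2011.isOpen_pairLayerSubgroup κ₁ κ₂ n) k i γ y

/-- **Compatibility with the constants** (all degrees; `relCoresO_levelScalarO`). [cite: NeukirchSchmidtWingberg2008, I §5 Prop. 1.5.2] -/
theorem spLevel_layerScalarO (n k i : ℕ) (c : padicCoeffIntegers S) (y : layerCohO S κ₁ κ₂ θ 𝔣 n k i) :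
    spLevel S κ₁ κ₂ θ 𝔣 n k i (layerScalarO S κ₁ κ₂ θ 𝔣 n k i c y) = cycLayerScalarO S κ₁ θ (suppPF p 𝔣) n k i c (spLevel S κ₁ κ₂ θ 𝔣 n k i y) :=
  relCoresO_levelScalarO S (suppPF p 𝔣) θ (inf_le_left : JohnsonLeungKings2011.pairLayerSubgroup κ₁ κ₂ n ≤ κ₁.layerSubgroup n)
    (κ₁.isOpen_layerSubgroup n) (JohnsonLeungKings2011.isOpen_pairLayerSubgroup κ₁ κ₂ n) k i c y

end Level

/-! ## §2 The corestriction on the pinned data (degree `1`) -/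

section Data

variable {K : Type} [Field K] [NumberField K] {p : ℕ} [Fact p.Prime] {S : Set (PadicAlgCl p)}
  {κ₁ κ₂ : ZpExtension K p} {γ₁ γ₂ : absoluteGaloisGroup K} {θ : absoluteGaloisGroup K →ₜ* (padicCoeffIntegers S)ˣ} {𝔣 : Ideal (𝓞 K)}
  (D₂ : IwasawaCohomologyDataO S κ₁ κ₂ γ₁ γ₂ θ 𝔣 1) (D₁ : CycIwasawaCohomologyDataO S κ₁ γ₁ θ (suppPF p 𝔣) 1)

/-- **The corestricted family of a two-variable class is compatible**: `(cor_{K̃_n/K^{(1)}_n} (proj n k x))_{n,k}` is compatible with the `κ₁`-tower's cores and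
reductions. [cite: NeukirchSchmidtWingberg2008, I §5 Prop. 1.5.2–1.5.3] -/
theorem spLevel_proj_compatible (x : D₂.H) :
    (∀ n k, cycLayerCoresO S κ₁ θ (suppPF p 𝔣) n k 1 (spLevel S κ₁ κ₂ θ 𝔣 (n + 1) k 1 (D₂.proj (n + 1) k x)) = spLevel S κ₁ κ₂ θ 𝔣 n k 1 (D₂.proj n k x)) ∧
      ∀ n k, cycLayerRedO S κ₁ θ (suppPF p 𝔣) n k 1 (spLevel S κ₁ κ₂ θ 𝔣 n (k + 1) 1 (D₂.proj n (k + 1) x)) = spLevel S κ₁ κ₂ θ 𝔣 n k 1 (D₂.proj n k x) :=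
  ⟨fun n k ↦ by rw [← spLevel_layerCoresO_one, D₂.proj_cores], fun n k ↦ by rw [← spLevel_layerRedO, D₂.proj_red]⟩

/-- ★★ **The corestriction `res : 𝐇¹(𝒪_K[1/p𝔣], Λ_{𝒪,2}(θ)(1)) → 𝐇¹_{supp(p𝔣)}(K^{(1)}_∞/K, 𝒪(θ)(1))` EXISTS on the pinned data**, pinned levelwise by
`D₁.proj n k (res x) = cor_{K̃_n/K^{(1)}_n} (D₂.proj n k x)` ((P4) of `D₁` on the compatible corestricted family; additivity by (P3)).
[cite: NeukirchSchmidtWingberg2008, I §5 Prop. 1.5.2–1.5.4] [cite: Kato2004Asterisque, §12.2 (12.2.1) (p. 220)] -/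
theorem exists_coresHom : ∃ res : D₂.H →+ D₁.H, ∀ (n k : ℕ) (x : D₂.H), D₁.proj n k (res x) = spLevel S κ₁ κ₂ θ 𝔣 n k 1 (D₂.proj n k x) := by
  choose r hr using fun x : D₂.H ↦
    D₁.proj_surjective (fun n k ↦ spLevel S κ₁ κ₂ θ 𝔣 n k 1 (D₂.proj n k x)) (spLevel_proj_compatible D₂ x).1 (spLevel_proj_compatible D₂ x).2
  refine ⟨{ toFun := r, map_zero' := ?_, map_add' := fun x y ↦ ?_ }, fun n k x ↦ hr x n k⟩
  · exact D₁.proj_injective _ fun n k ↦ by rw [hr, map_zero, map_zero]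
  · refine sub_eq_zero.mp (D₁.proj_injective _ fun n k ↦ ?_)
    rw [map_sub, map_add, hr, hr, hr, map_add, map_add, sub_self]

/-- **Uniqueness**: the levelwise pin determines `res` ((P3) of `D₁`). [cite: Kato2004Asterisque, §8.2 (p. 180)] -/
theorem coresHom_unique {res res' : D₂.H →+ D₁.H} (h : ∀ n k x, D₁.proj n k (res x) = spLevel S κ₁ κ₂ θ 𝔣 n k 1 (D₂.proj n k x))
    (h' : ∀ n k x, D₁.proj n k (res' x) = spLevel S κ₁ κ₂ θ 𝔣 n k 1 (D₂.proj n k x)) : res = res' := by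
  ext x
  refine sub_eq_zero.mp (D₁.proj_injective _ fun n k ↦ ?_)
  rw [map_sub, h, h', sub_self]

variable {D₂ D₁} {res : D₂.H →+ D₁.H} (hres : ∀ (n k : ℕ) (x : D₂.H), D₁.proj n k (res x) = spLevel S κ₁ κ₂ θ 𝔣 n k 1 (D₂.proj n k x))
include hres

/-- ★ **`res (T₁ • x) = T • res x`**: the outer variable of `Λ_{𝒪,2} = 𝒪⟦T₂⟧⟦T₁⟧` (`conj_{γ₁} − 1`, (P5) of `D₂`) goes to the variable of `Λ_𝒪 = 𝒪⟦T⟧` (`conj_{γ₁} − 1`, (P5)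
of `D₁`): the corestrictions intertwine the conjugations. [cite: NeukirchSchmidtWingberg2008, I §5 Prop. 1.5.4] [cite: JohnsonLeungKings2011, §4.2 (arXiv p0012:L109–112)] -/
theorem coresHom_X_smul (x : D₂.H) : res ((PowerSeries.X : IwasawaAlgebraO₂ S) • x) = (PowerSeries.X : IwasawaAlgebraO S) • res x := by
  refine sub_eq_zero.mp (D₁.proj_injective _ fun n k ↦ ?_)
  rw [map_sub, hres, D₂.proj_T₁_smul, D₁.proj_X_smul, hres, map_sub, spLevel_layerConjO, sub_self]

/-- ★ **`res (C (C c) • x) = C c • res x`**: the constants (coefficient multiplication `H¹(c ⊗ id)`, (P7) on both sides; the corestrictions are `𝒪`-linear).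
[cite: NeukirchSchmidtWingberg2008, I §5 Prop. 1.5.2] [cite: JohnsonLeungKings2011, §4.1 Def. 4.1 (arXiv p0012:L59–60)] -/
theorem coresHom_C_C_smul (c : padicCoeffIntegers S) (x : D₂.H) :
    res ((PowerSeries.C (PowerSeries.C c : PowerSeries (padicCoeffIntegers S)) : IwasawaAlgebraO₂ S) • x) = (PowerSeries.C c : IwasawaAlgebraO S) • res x := by
  refine sub_eq_zero.mp (D₁.proj_injective _ fun n k ↦ ?_)
  rw [map_sub, hres, D₂.proj_C_smul, D₁.proj_C_smul, hres, spLevel_layerScalarO, sub_self]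

/-- ★ **The `T₂`-clause**: `D₁.proj n k (res (C X • x)) = conj_{γ₂} (D₁.proj n k (res x)) − D₁.proj n k (res x)` — the inner variable `T₂ = C X` (`conj_{γ₂} − 1`, (P6) of `D₂`)
goes to the conjugation by `γ₂` on the levels of the `κ₁`-line (NOT a scalar: the twisted specialisation `(1+T₂) ↦ u` of the junction needs the twist `tw` first, J2-a).
[cite: NeukirchSchmidtWingberg2008, I §5 Prop. 1.5.4] [cite: JohnsonLeungKings2011, §4.2 (arXiv p0012:L109–112)] -/
theorem proj_coresHom_C_X_smul (n k : ℕ) (x : D₂.H) :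
    D₁.proj n k (res ((PowerSeries.C (PowerSeries.X : PowerSeries (padicCoeffIntegers S)) : IwasawaAlgebraO₂ S) • x)) =
      cycLayerConjO S κ₁ θ (suppPF p 𝔣) n k 1 γ₂ (D₁.proj n k (res x)) - D₁.proj n k (res x) := by
  rw [hres, D₂.proj_T₂_smul, hres, map_sub, spLevel_layerConjO]

/-- ★ **If `γ₂ ∈ Gal(K̄/K^{(1)}_∞)` (a basis `(γ₁, γ₂)` dual to `(κ₁, κ₂)`) then `res (C X • x) = 0`**: `γ₂` lies in every `κ₁.layerSubgroup n` and acts trivially on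
`H¹(G_S(K^{(1)}_n), ·)` (inner automorphism, `levelConjO_eq_self_of_mem`), so `res` kills `T₂ • 𝐇¹₂` and factors through the UNTWISTED specialisation `𝐇¹₂ / T₂`.
[cite: SerreLocalFields1979, VII §5 Prop. 3] [cite: JohnsonLeungKings2011, §4.2 (arXiv p0012:L109–112)] -/
theorem coresHom_C_X_smul_eq_zero (hγ₂ : γ₂ ∈ κ₁.kerSubgroup) (x : D₂.H) :
    res ((PowerSeries.C (PowerSeries.X : PowerSeries (padicCoeffIntegers S)) : IwasawaAlgebraO₂ S) • x) = 0 := by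
  refine D₁.proj_injective _ fun n k ↦ ?_
  rw [proj_coresHom_C_X_smul hres, cycLayerConjO,
    levelConjO_eq_self_of_mem S (suppPF p 𝔣) θ (κ₁.kerSubgroup_le_layerSubgroup n hγ₂) (κ₁.isOpen_layerSubgroup n) k (Nat.le_succ 1), sub_self]

/-- **`res` maps `ker (D₂.proj n k)` into `ker (D₁.proj n k)`** (continuity of the corestriction at each level). [cite: Kato2004Asterisque, §8.2 (p. 180)] -/
theorem proj_coresHom_eq_zero {n k : ℕ} {x : D₂.H} (hx : D₂.proj n k x = 0) : D₁.proj n k (res x) = 0 := by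
  rw [hres, hx, map_zero]

end Data

end Summit.BirchSwinnertonDyer.BirchSwinnertonDyer.Theorems.SmallImageRttD2J2

end
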